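import Summits.AnomalousDissipation.AnomalousDissipation.Theorems.SolenoidalFractalHomogenisationLagrangianCarrierConstructionRegularLConjugation
import Summits.AnomalousDissipation.AnomalousDissipation.Theorems.SolenoidalFractalHomogenisationLagrangianCarrierConstructionRegularLEvolutionC2
import Summits.AnomalousDissipation.AnomalousDissipation.Theorems.SolenoidalFractalHomogenisationLagrangianCarrierConstructionRegularLLevelC2
import HarnessLib

/-!
# K3L `LagrangianCarrierConstruction` (stmt-AnomalousDissipation-24913), line `birth`, stub `stub_regularL`: the DISTORTION TOWER —
# uniform `C¹` distortion and `C²` curvature of the Lagrangian flows on the refresh windows, under a strain-budget ceiling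
# (helper; `--supports stmt-AnomalousDissipation-24913`)

Summits-side helper file (everything proved; no definitions, no named facts). The quantitative core of `stub_regularL` (v8: strain-budget
ceiling `θ₀ ≤ θs(k, W)`, idea card `Cruxes/LagrangianCarrierConstruction/Ideas/distortion-trapping-ceiling.md`). For the abstract carrier `E`
(`IsLagrangian` + qualitative clauses + nested windows (W2) + strain (S) `S_m R_{m+1} ≤ θ_{m+1} ≤ θ₀`, `S_m = a_1 + ⋯ + a_m`,
separation `N_m² ≤ N_{m+1}`, `2N_m ≤ N_{m+1}`) and the evolution maps `Φ_m(s→t)` of the lifted coarse fields, by induction on `m`,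
for all `s, t` in ONE refresh window of level `m+1` (`distortion_tower`):

* (D1′) `‖DΦ_m(s→t)(z) − I‖ ≤ (121/100)(e^{M S_m |t−s|} − 1) + (33/10) L U θ₀ S_m |t−s|`,
* (D1)  `‖DΦ_m(s→t)(z) − I‖ ≤ 1/10`,
* (D2)  `‖DΦ_m(s→t)(z) − DΦ_m(s→t)(z')‖ ≤ 3 L θ₀ N_m² ‖z − z'‖`,

where `M = 3√3 k`, `U = k/(2π)` and `L = L_W` are the gradient / sup / Hessian constants of the lifted Eulerian levels (`…RegularLLevelC2`), provided
`θ₀ ≤ 1`, `60 M θ₀ ≤ 1`, `66 L U θ₀ ≤ 1`. The step uses the window conjugation identity `Φ_{m+1}(s→t) = Φ_m(w→t) ∘ Ψ_{m+1}(s→t) ∘ Φ_m(s→w)`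
(`…RegularLConjugation`), the Eulerian flow bounds `‖DΨ − I‖ ≤ e^{M a_{m+1}|t−s|} − 1`, `Lip DΨ ≤ L a_{m+1} N_{m+1} |t−s| e^{3Ma_{m+1}|t−s|}`,
`‖Ψ y − y‖ ≤ U (a_{m+1}/N_{m+1}) |t−s|` (`…RegularLEvolutionC2`), and the near-identity calculus (`…RegularLNearIdentity`): (D1′) telescopes
EXACTLY in the time span thanks to `Φ_m(w→t) ∘ Φ_m(s→w) = Φ_m(s→t)` (conjugated insertion), the mismatch `Lip(DΦ_m) · ‖Ψ y − y‖` gaining the factor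
`N_m²/N_{m+1} ≤ 1`; (D2) is a plain composition bound whose growth factor `(11/10)⁴ + (11/10)² < 3` is absorbed by `4 N_m² ≤ N_{m+1}²`. No
derivative loss occurs because the identity expresses `Φ_{m+1}` through `Φ_m` and the explicit `Ψ` at the same order (Armstrong–Vicol control
the same two quantities with the absolute window constant `2^{−25}`: arXiv:2305.05048 Prop. 2.2, Cor. 2.4, pp. 19–26).
Infrastructure for route-1's rung leaf F-D1.A0 (a frontier FORMAL rung); NOT a proof of anomalous dissipation.
-/

set_option linter.dupNamespace false

noncomputable section

namespace Summit.AnomalousDissipation.AnomalousDissipation.Theorems.SolenoidalFractalHomogenisation.LagrangianCarrierConstruction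

open Set Function Filter Topology MeasureTheory
open scoped NNReal ContDiff
open Literature.Analysis Literature.Analysis.ODE Literature.Analysis.FunctionSpaces Literature.Analysis.FunctionSpaces.Torus
open Literature.Analysis.FluidPDE Literature.Analysis.FluidPDE.LatticeShear

variable {k : ℕ}

/-! ## Elementary numerics -/

/-- `(e^x − 1) + (e^y − 1) ≤ e^{x+y} − 1` for `x, y ≥ 0`. [folklore] -/
theorem exp_sub_one_add_le {x y : ℝ} (hx : 0 ≤ x) (hy : 0 ≤ y) :
    (Real.exp x - 1) + (Real.exp y - 1) ≤ Real.exp (x + y) - 1 := by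
  rw [Real.exp_add]
  have h1 : 0 ≤ Real.exp x - 1 := by linarith [Real.add_one_le_exp x]
  have h2 : 0 ≤ Real.exp y - 1 := by linarith [Real.add_one_le_exp y]
  nlinarith

/-- The strain-budget ceiling closes the first-order bootstrap: for `0 ≤ x ≤ θ₀ ≤ 1`, `60 M θ₀ ≤ 1`, `66 L U θ₀ ≤ 1`,
`(121/100)(e^{Mx} − 1) + (33/10) L U θ₀ x ≤ 1/10`. [cite: ArmstrongVicol2025, Cor. 2.4 (p. 22: ‖∇X − I‖ ≤ 1/4 under the window constraint)] -/
theorem ceiling_closure {M L U θ₀ x : ℝ} (hM : 0 ≤ M) (hL : 0 ≤ L) (hU : 0 ≤ U) (hθ0 : 0 ≤ θ₀) (hθ1 : θ₀ ≤ 1)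
    (hθM : 60 * (M * θ₀) ≤ 1) (hθL : 66 * (L * U * θ₀) ≤ 1) (hx0 : 0 ≤ x) (hx : x ≤ θ₀) :
    121 / 100 * (Real.exp (M * x) - 1) + 33 / 10 * L * U * θ₀ * x ≤ 1 / 10 := by
  have hMx : M * x ≤ 1 := by nlinarith
  have h1 : Real.exp (M * x) - 1 ≤ 2 * (M * x) := by
    have h := Real.abs_exp_sub_one_sub_id_le (x := M * x) (by rw [abs_of_nonneg (mul_nonneg hM hx0)]; exact hMx)
    have h' : Real.exp (M * x) - 1 - M * x ≤ (M * x) ^ 2 := (le_abs_self _).trans h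
    nlinarith [mul_nonneg hM hx0]
  have h2 : 2 * (M * x) ≤ 2 * (M * θ₀) := by nlinarith
  have h3 : L * U * θ₀ * x ≤ L * U * θ₀ * θ₀ := mul_le_mul_of_nonneg_left hx (by positivity)
  have h4 : L * U * θ₀ * θ₀ ≤ L * U * θ₀ * 1 := mul_le_mul_of_nonneg_left hθ1 (by positivity)
  nlinarith

/-! ## The tower -/

set_option maxHeartbeats 400000 in
/-- **The distortion tower.** See the module docstring: (D1′), (D1), (D2) for every level `m` and all `s, t` in one refresh window of level
`m+1`, by induction on `m` through the window conjugation identity. [cite: ArmstrongVicol2025, Prop. 2.2 (p. 19) and Cor. 2.4 (p. 22); §5.1] -/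
theorem distortion_tower (E : LagrangianLatticeCarrier k) (θ₀ : ℝ) (hL : E.IsLagrangian)
    (h1 : ∀ m, Continuous (uncurry (E.b (m + 1)))) (h3a : ∀ m t, IsSmooth (E.b (m + 1) t))
    (h3b : ∀ m (n : ℕ), ∃ C : ℝ, ∀ t y, ‖iteratedFDeriv ℝ n (Torus.lift (E.b (m + 1) t)) y‖ ≤ C)
    (hF1a : ∀ m s, Continuous fun p : ℝ × UnitAddTorus (Fin 3) => E.disp m p.1 s p.2)
    (hF1b : ∀ m t s, IsSmooth (E.disp m t s))
    (hW2 : ∀ m, ∃ q : ℕ, 0 < q ∧ E.refresh m = (q : ℝ) * E.refresh (m + 1))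
    (hS : ∀ m, E.strain m ≤ E.θ (m + 1)) (hθ : ∀ m, E.θ (m + 1) ≤ θ₀)
    (hN0 : E.N 0 = 1) (hN2 : ∀ m, 2 * E.N m ≤ E.N (m + 1)) (hsq : ∀ m, E.N m ^ 2 ≤ E.N (m + 1))
    {L : ℝ} (hL0 : 0 ≤ L)
    (hL2 : ∀ (m : ℕ) (t : ℝ) (z : EuclideanSpace ℝ (Fin 3)),
      ‖iteratedFDeriv ℝ 2 (fun z : EuclideanSpace ℝ (Fin 3) => E.toFractalCarrierData.level m t (proj z)) z‖ ≤
        L * E.a m * E.N m)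
    (hθ1 : θ₀ ≤ 1) (hθM : 60 * (Real.sqrt 3 * (3 * k) * θ₀) ≤ 1) (hθL : 66 * (L * (k / (2 * Real.pi)) * θ₀) ≤ 1) :
    ∀ (m : ℕ) (j : ℤ) (s t : ℝ), s ∈ E.window (m + 1) j → t ∈ E.window (m + 1) j →
      (∀ z, ‖fderiv ℝ (evolutionMap (fun t (z : EuclideanSpace ℝ (Fin 3)) => E.partialSum m t (proj z)) s t) z -
          ContinuousLinearMap.id ℝ (EuclideanSpace ℝ (Fin 3))‖ ≤
        121 / 100 * (Real.exp (Real.sqrt 3 * (3 * k) * (∑ i ∈ Finset.range m, E.a (i + 1)) * |t - s|) - 1) +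
          33 / 10 * L * (k / (2 * Real.pi)) * θ₀ * (∑ i ∈ Finset.range m, E.a (i + 1)) * |t - s|) ∧
      (∀ z, ‖fderiv ℝ (evolutionMap (fun t (z : EuclideanSpace ℝ (Fin 3)) => E.partialSum m t (proj z)) s t) z -
          ContinuousLinearMap.id ℝ (EuclideanSpace ℝ (Fin 3))‖ ≤ 1 / 10) ∧
      (∀ z z', ‖fderiv ℝ (evolutionMap (fun t (z : EuclideanSpace ℝ (Fin 3)) => E.partialSum m t (proj z)) s t) z -
          fderiv ℝ (evolutionMap (fun t (z : EuclideanSpace ℝ (Fin 3)) => E.partialSum m t (proj z)) s t) z'‖ ≤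
        3 * L * θ₀ * (E.N m : ℝ) ^ 2 * ‖z - z'‖) := by
  -- constants
  set M : ℝ := Real.sqrt 3 * (3 * k) with hM
  set U : ℝ := k / (2 * Real.pi) with hU
  have hM0 : 0 ≤ M := by positivity
  have hU0 : 0 ≤ U := by positivity
  have hθ0 : 0 ≤ θ₀ := by
    have h := (hS 0).trans (hθ 0)
    rwa [LagrangianLatticeCarrier.strain_zero] at h
  -- notation-free abbreviations
  have hapos : ∀ i, 0 < E.a i := E.toFractalCarrierData.a_pos
  have hSnonneg : ∀ m, 0 ≤ ∑ i ∈ Finset.range m, E.a (i + 1) := fun m =>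
    Finset.sum_nonneg fun i _ => (hapos _).le
  -- the strain clause in the form used: `S_m · |t − s| ≤ θ₀` for `s, t` in one window of level `m+1`
  have hstrain : ∀ (m : ℕ) (j : ℤ) (s t : ℝ), s ∈ E.window (m + 1) j → t ∈ E.window (m + 1) j →
      (∑ i ∈ Finset.range m, E.a (i + 1)) * |t - s| ≤ θ₀ := by
    intro m j s t hs ht
    have hlt := abs_sub_lt_refresh_of_mem_window E (m + 1) j hs ht
    calc (∑ i ∈ Finset.range m, E.a (i + 1)) * |t - s| ≤ (∑ i ∈ Finset.range m, E.a (i + 1)) * E.refresh (m + 1) :=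
          mul_le_mul_of_nonneg_left hlt.le (hSnonneg m)
      _ = E.strain m := rfl
      _ ≤ θ₀ := (hS m).trans (hθ m)
  -- the Eulerian levels: Cauchy–Lipschitz, slabs, the three constants, the flows `Ψ`
  have hvU : ∀ m, IsUniformlyLipschitzOn (fun t (z : EuclideanSpace ℝ (Fin 3)) => E.toFractalCarrierData.level m t (proj z)) univ :=
    fun m => isUniformlyLipschitzOn_level_proj E.toFractalCarrierData m
  have hvloc : ∀ m (r : ℝ), ∃ ε > 0,
      ContDiffOn ℝ ∞ (uncurry fun t (z : EuclideanSpace ℝ (Fin 3)) => E.toFractalCarrierData.level m t (proj z)) (Icc r (r + ε) ×ˢ univ) ∧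
      ContDiffOn ℝ ∞ (uncurry fun t (z : EuclideanSpace ℝ (Fin 3)) => E.toFractalCarrierData.level m t (proj z)) (Icc (r - ε) r ×ˢ univ) :=
    fun m r => exists_contDiffOn_slabs_level_proj (n := (⊤ : ℕ∞)) E.toFractalCarrierData m r
  have hvM : ∀ m t y, ‖fderiv ℝ (fun z : EuclideanSpace ℝ (Fin 3) => E.toFractalCarrierData.level m t (proj z)) y‖ ≤ M * E.a m := by
    intro m t y
    have h := norm_fderiv_level_proj_le E.toFractalCarrierData m t y
    rw [hM]; linarith
  have hvsup : ∀ m t y, ‖E.toFractalCarrierData.level m t (proj y)‖ ≤ U * E.a m / E.N m := by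
    intro m t y
    have h := norm_level_proj_le E.toFractalCarrierData m t y
    rw [hU]
    calc ‖E.toFractalCarrierData.level m t (proj y)‖ ≤ k * E.a m / (2 * Real.pi * E.N m) := h
      _ = k / (2 * Real.pi) * E.a m / E.N m := by ring
  -- differentiability of the flows
  have hΦd : ∀ m s t, Differentiable ℝ (evolutionMap (fun t (z : EuclideanSpace ℝ (Fin 3)) => E.partialSum m t (proj z)) s t) :=
    fun m s t => differentiable_evolutionMap_partialSum E m (hL m).1 h1 h3a h3b hF1a hF1b s t
  have hΨd : ∀ m s t, Differentiable ℝ (evolutionMap (fun t (z : EuclideanSpace ℝ (Fin 3)) => E.toFractalCarrierData.level m t (proj z)) s t) := by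
    intro m s t
    have hloc1 : ∀ r : ℝ, ∃ ε > 0,
        ContDiffOn ℝ 1 (uncurry fun t (z : EuclideanSpace ℝ (Fin 3)) => E.toFractalCarrierData.level m t (proj z)) (Icc r (r + ε) ×ˢ univ) ∧
        ContDiffOn ℝ 1 (uncurry fun t (z : EuclideanSpace ℝ (Fin 3)) => E.toFractalCarrierData.level m t (proj z)) (Icc (r - ε) r ×ˢ univ) :=
      fun r => exists_contDiffOn_slabs_level_proj (n := 1) E.toFractalCarrierData m r
    exact (contDiff_evolutionMap_of_local (hvU m) le_rfl hloc1 s t).differentiable (by simp)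
  have hBU : ∀ m, IsUniformlyLipschitzOn (fun t (z : EuclideanSpace ℝ (Fin 3)) => E.partialSum m t (proj z)) univ := fun m =>
    isUniformlyLipschitzOn_partialSum_proj E h1 h3a h3b m
  -- real-cast separation facts
  have hNpos : ∀ m, (0 : ℝ) < E.N m := fun m => by exact_mod_cast E.toFractalCarrierData.N_pos m
  have hN2' : ∀ m, (2 : ℝ) * E.N m ≤ E.N (m + 1) := fun m => by exact_mod_cast hN2 m
  have hsq' : ∀ m, (E.N m : ℝ) ^ 2 ≤ E.N (m + 1) := fun m => by exact_mod_cast hsq m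
  -- INDUCTION on the level
  intro m
  induction m with
  | zero =>
    intro j s t hs ht
    -- `Φ_0 = id`: the coarse field below level `1` vanishes
    have e : evolutionMap (fun t (z : EuclideanSpace ℝ (Fin 3)) => E.partialSum 0 t (proj z)) s t = id := by
      funext z
      exact (hBU 0).evolutionMap_eq_self_of_forall_eq_zero convex_univ
        (fun r _ => LagrangianLatticeCarrier.partialSum_zero E r (proj z)) (mem_univ s) (mem_univ t)
    simp only [e, fderiv_id, sub_self, norm_zero, Finset.range_zero, Finset.sum_empty, mul_zero, zero_mul,
      Real.exp_zero, add_zero]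
    refine ⟨fun _ => le_rfl, fun _ => by norm_num, fun z z' => by positivity⟩
  | succ m ih =>
    intro j s t hs ht
    -- the enclosing window of level `m+1`, its left end `w`, and the conjugation identity
    obtain ⟨j', hjj'⟩ := exists_window_succ_subset E hW2 m j
    have hs' : s ∈ E.window (m + 1) j' := hjj' hs
    have ht' : t ∈ E.window (m + 1) j' := hjj' ht
    set w : ℝ := (j' : ℝ) * E.refresh (m + 1) with hw
    have hw' : w ∈ E.window (m + 1) j' := left_mem_window E (m + 1) j'
    set f := evolutionMap (fun t (z : EuclideanSpace ℝ (Fin 3)) => E.partialSum m t (proj z)) w t with hf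
    set g := evolutionMap (fun t (z : EuclideanSpace ℝ (Fin 3)) => E.partialSum m t (proj z)) s w with hg
    set h := evolutionMap (fun t (z : EuclideanSpace ℝ (Fin 3)) => E.partialSum m t (proj z)) s t with hh
    set ψ := evolutionMap (fun t (z : EuclideanSpace ℝ (Fin 3)) => E.toFractalCarrierData.level (m + 1) t (proj z)) s t with hψ
    have hconj : evolutionMap (fun t (z : EuclideanSpace ℝ (Fin 3)) => E.partialSum (m + 1) t (proj z)) s t = f ∘ ψ ∘ g := by
      funext z
      exact evolutionMap_partialSum_succ_eq_conj E m hL h1 h3a h3b hF1a hF1b j' hs' ht' z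
    have hfg : ∀ z, f (g z) = h z := fun z => evolutionMap_trans_univ (hBU m) s w t z
    -- the induction hypothesis on the three coarse pairs
    obtain ⟨-, hδf, hβf⟩ := ih j' w t hw' ht'
    obtain ⟨-, hδg, hβg⟩ := ih j' s w hs' hw'
    obtain ⟨hδh, -, -⟩ := ih j' s t hs' ht'
    -- the time span and the strain budget of level `m+1`
    set τ : ℝ := |t - s| with hτ
    have hτ0 : 0 ≤ τ := abs_nonneg _
    have haτ : E.a (m + 1) * τ ≤ θ₀ := by
      have h := hstrain (m + 1) j s t hs ht
      rw [Finset.sum_range_succ] at h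
      have : E.a (m + 1) * τ ≤ (∑ i ∈ Finset.range m, E.a (i + 1) + E.a (m + 1)) * τ :=
        mul_le_mul_of_nonneg_right (le_add_of_nonneg_left (hSnonneg m)) hτ0
      exact this.trans h
    have haτ0 : 0 ≤ E.a (m + 1) * τ := mul_nonneg (hapos _).le hτ0
    have hx1 : M * (E.a (m + 1) * τ) ≤ 1 / 60 := by
      have h := mul_le_mul_of_nonneg_left haτ hM0
      linarith
    -- the Eulerian flow `ψ`: distortion `ε`, displacement `η`, curvature `λ`
    have hΨ := norm_fderiv_evolutionMap_bounds_of_local (hvU (m + 1)) (hvloc (m + 1)) (hvM (m + 1)) (hL2 (m + 1)) s t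
    set ε : ℝ := Real.exp (M * E.a (m + 1) * τ) - 1 with hε
    have hε0 : 0 ≤ ε := by
      have hx0 : 0 ≤ M * E.a (m + 1) * τ := mul_nonneg (mul_nonneg hM0 (hapos _).le) hτ0
      rw [hε]; linarith [Real.add_one_le_exp (M * E.a (m + 1) * τ), hx0]
    have hεb : ∀ z, ‖fderiv ℝ ψ z - ContinuousLinearMap.id ℝ (EuclideanSpace ℝ (Fin 3))‖ ≤ ε := fun z => by
      simpa only [hε, hψ] using hΨ.1 z
    have hε1 : ε ≤ 1 / 10 := by
      have hy0 : 0 ≤ M * (E.a (m + 1) * τ) := mul_nonneg hM0 haτ0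
      have h := Real.abs_exp_sub_one_sub_id_le (x := M * (E.a (m + 1) * τ)) (by rw [abs_of_nonneg hy0]; linarith)
      have h' : Real.exp (M * (E.a (m + 1) * τ)) - 1 - M * (E.a (m + 1) * τ) ≤ (M * (E.a (m + 1) * τ)) ^ 2 :=
        (le_abs_self _).trans h
      rw [hε, mul_assoc]; nlinarith
    set η : ℝ := U * E.a (m + 1) / E.N (m + 1) * τ with hη
    have hη0 : 0 ≤ η := by have := hNpos (m + 1); have := hapos (m + 1); positivity
    have hηb : ∀ z, ‖ψ z - z‖ ≤ η := fun z =>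
      norm_evolutionMap_sub_self_le_univ (hvU (m + 1)) (hvsup (m + 1)) s t z
    set lam : ℝ := L * E.a (m + 1) * E.N (m + 1) * τ * Real.exp (3 * (M * E.a (m + 1)) * τ) with hlam
    have hlam0 : 0 ≤ lam := by have := hNpos (m + 1); have := hapos (m + 1); positivity
    have hlamb : ∀ z z', ‖fderiv ℝ ψ z - fderiv ℝ ψ z'‖ ≤ lam * ‖z - z'‖ := fun z z' => by
      have h := hΨ.2 z z'
      rw [hlam]
      calc ‖fderiv ℝ ψ z - fderiv ℝ ψ z'‖
          ≤ L * E.a (m + 1) * E.N (m + 1) * |t - s| * Real.exp (3 * (M * E.a (m + 1)) * |t - s|) * ‖z - z'‖ := h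
        _ = _ := by rw [hτ]
    have hexp3 : Real.exp (3 * (M * E.a (m + 1)) * τ) ≤ 11 / 10 := by
      have e3 : 3 * (M * E.a (m + 1)) * τ = 3 * (M * (E.a (m + 1) * τ)) := by ring
      have hy0 : 0 ≤ 3 * (M * (E.a (m + 1) * τ)) := mul_nonneg (by norm_num) (mul_nonneg hM0 haτ0)
      have h := Real.abs_exp_sub_one_sub_id_le (x := 3 * (M * (E.a (m + 1) * τ))) (by rw [abs_of_nonneg hy0]; linarith)
      have h' : Real.exp (3 * (M * (E.a (m + 1) * τ))) - 1 - 3 * (M * (E.a (m + 1) * τ)) ≤ (3 * (M * (E.a (m + 1) * τ))) ^ 2 :=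
        (le_abs_self _).trans h
      rw [e3]
      nlinarith
    have hlam1 : lam ≤ 11 / 10 * L * θ₀ * E.N (m + 1) := by
      rw [hlam]
      have hN := hNpos (m + 1)
      calc L * E.a (m + 1) * E.N (m + 1) * τ * Real.exp (3 * (M * E.a (m + 1)) * τ)
          = L * E.N (m + 1) * (E.a (m + 1) * τ) * Real.exp (3 * (M * E.a (m + 1)) * τ) := by ring
        _ ≤ L * E.N (m + 1) * θ₀ * (11 / 10) := by
            gcongr
        _ = 11 / 10 * L * θ₀ * E.N (m + 1) := by ring
    -- (D1′): conjugated insertion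
    have hD1' : ∀ z, ‖fderiv ℝ (f ∘ ψ ∘ g) z - ContinuousLinearMap.id ℝ (EuclideanSpace ℝ (Fin 3))‖ ≤
        121 / 100 * (Real.exp (M * (∑ i ∈ Finset.range (m + 1), E.a (i + 1)) * τ) - 1) +
          33 / 10 * L * U * θ₀ * (∑ i ∈ Finset.range (m + 1), E.a (i + 1)) * τ := by
      intro z
      have hβf0 : 0 ≤ 3 * L * θ₀ * (E.N m : ℝ) ^ 2 := by positivity
      have hc := norm_fderiv_conj_sub_id_le (hΦd m w t) (hΦd m s w) (hΨd (m + 1) s t) hfg hβf0 hδf hδg hβf hεb hηb z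
      refine hc.trans ?_
      have hh := hδh z
      -- `(11/10) ε (11/10) + Γ_m η (11/10) + D1′(m)` ≤ `D1′(m+1)`
      have hterm2 : 3 * L * θ₀ * (E.N m : ℝ) ^ 2 * η * (1 + 1 / 10) ≤ 33 / 10 * L * U * θ₀ * E.a (m + 1) * τ := by
        rw [hη]
        have hN := hNpos (m + 1)
        have hratio : (E.N m : ℝ) ^ 2 / E.N (m + 1) ≤ 1 := (div_le_one hN).2 (hsq' m)
        have hc0 : 0 ≤ 33 / 10 * L * U * θ₀ * E.a (m + 1) * τ :=
          mul_nonneg (mul_nonneg (mul_nonneg (mul_nonneg (mul_nonneg (by norm_num) hL0) hU0) hθ0) (hapos _).le) hτ0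
        calc 3 * L * θ₀ * (E.N m : ℝ) ^ 2 * (U * E.a (m + 1) / E.N (m + 1) * τ) * (1 + 1 / 10)
            = 33 / 10 * L * U * θ₀ * E.a (m + 1) * τ * ((E.N m : ℝ) ^ 2 / E.N (m + 1)) := by ring
          _ ≤ 33 / 10 * L * U * θ₀ * E.a (m + 1) * τ * 1 := mul_le_mul_of_nonneg_left hratio hc0
          _ = 33 / 10 * L * U * θ₀ * E.a (m + 1) * τ := by ring
      have hterm1 : (1 + 1 / 10) * ε * (1 + 1 / 10) = 121 / 100 * ε := by ring
      have hexpadd : ε + (Real.exp (M * (∑ i ∈ Finset.range m, E.a (i + 1)) * τ) - 1) ≤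
          Real.exp (M * (∑ i ∈ Finset.range (m + 1), E.a (i + 1)) * τ) - 1 := by
        rw [hε, Finset.sum_range_succ]
        have e : M * (∑ i ∈ Finset.range m, E.a (i + 1) + E.a (m + 1)) * τ =
            M * E.a (m + 1) * τ + M * (∑ i ∈ Finset.range m, E.a (i + 1)) * τ := by ring
        rw [e]
        exact exp_sub_one_add_le (mul_nonneg (mul_nonneg hM0 (hapos _).le) hτ0) (mul_nonneg (mul_nonneg hM0 (hSnonneg m)) hτ0)
      rw [Finset.sum_range_succ] at hexpadd ⊢
      rw [hterm1] at hc
      linarith [hterm2, hexpadd, hh, hε0]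
    -- (D1): the ceiling closes the bootstrap
    have hSτ : (∑ i ∈ Finset.range (m + 1), E.a (i + 1)) * τ ≤ θ₀ := hstrain (m + 1) j s t hs ht
    have hD1 : ∀ z, ‖fderiv ℝ (f ∘ ψ ∘ g) z - ContinuousLinearMap.id ℝ (EuclideanSpace ℝ (Fin 3))‖ ≤ 1 / 10 := by
      intro z
      refine (hD1' z).trans ?_
      have h := ceiling_closure (x := (∑ i ∈ Finset.range (m + 1), E.a (i + 1)) * τ) hM0 hL0 hU0 hθ0 hθ1 hθM hθL
        (mul_nonneg (hSnonneg _) hτ0) hSτ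
      have e1 : M * (∑ i ∈ Finset.range (m + 1), E.a (i + 1)) * τ = M * ((∑ i ∈ Finset.range (m + 1), E.a (i + 1)) * τ) := by ring
      have e2 : 33 / 10 * L * U * θ₀ * (∑ i ∈ Finset.range (m + 1), E.a (i + 1)) * τ =
          33 / 10 * L * U * θ₀ * ((∑ i ∈ Finset.range (m + 1), E.a (i + 1)) * τ) := by ring
      rw [e1, e2]; exact h
    -- (D2): composition of curvatures
    have hD2 : ∀ z z', ‖fderiv ℝ (f ∘ ψ ∘ g) z - fderiv ℝ (f ∘ ψ ∘ g) z'‖ ≤ 3 * L * θ₀ * (E.N (m + 1) : ℝ) ^ 2 * ‖z - z'‖ := by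
      intro z z'
      -- inner composition `ψ ∘ g`
      have hψg_d : Differentiable ℝ (ψ ∘ g) := (hΨd (m + 1) s t).comp (hΦd m s w)
      have hδψg : ∀ z, ‖fderiv ℝ (ψ ∘ g) z - ContinuousLinearMap.id ℝ (EuclideanSpace ℝ (Fin 3))‖ ≤ ε + 1 / 10 + ε * (1 / 10) :=
        fun z => norm_fderiv_comp_sub_id_le (hΨd (m + 1) s t) (hΦd m s w) hεb hδg z
      have hβψg : ∀ z z', ‖fderiv ℝ (ψ ∘ g) z - fderiv ℝ (ψ ∘ g) z'‖ ≤
          (lam * (1 + 1 / 10) ^ 2 + (1 + ε) * (3 * L * θ₀ * (E.N m : ℝ) ^ 2)) * ‖z - z'‖ :=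
        fun z z' => norm_fderiv_comp_sub_fderiv_comp_le (hΨd (m + 1) s t) (hΦd m s w) hlam0 hεb hδg hlamb hβg z z'
      -- outer composition `f ∘ (ψ ∘ g)`
      have hβf0 : 0 ≤ 3 * L * θ₀ * (E.N m : ℝ) ^ 2 := by positivity
      have hout := norm_fderiv_comp_sub_fderiv_comp_le (hΦd m w t) hψg_d hβf0 hδf hδψg hβf hβψg z z'
      refine hout.trans (mul_le_mul_of_nonneg_right ?_ (norm_nonneg _))
      -- numerics: growth factor `< 3` absorbed by `4 N_m² ≤ N_{m+1}²`, `λ ≤ (11/10) L θ₀ N_{m+1} ≤ (11/20) L θ₀ N_{m+1}²`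
      have hN := hNpos (m + 1)
      have h4 : 4 * (E.N m : ℝ) ^ 2 ≤ (E.N (m + 1) : ℝ) ^ 2 := by nlinarith only [hN2' m, hNpos m]
      have hN1 : (2 : ℝ) ≤ E.N (m + 1) := by
        have h := hN2' m
        have h0 : (1 : ℝ) ≤ E.N m := by exact_mod_cast E.toFractalCarrierData.N_pos m
        linarith
      have hNN : (E.N (m + 1) : ℝ) ≤ (E.N (m + 1) : ℝ) ^ 2 / 2 := by nlinarith only [hN1]
      have hLθ : 0 ≤ L * θ₀ := mul_nonneg hL0 hθ0
      -- linearise: the square of the inner distortion, the `(1+ε)` factor, then absorb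
      have hsq1 : (1 + (ε + 1 / 10 + ε * (1 / 10))) ^ 2 ≤ 3 / 2 := by nlinarith only [hε0, hε1]
      have t1 : 3 * L * θ₀ * (E.N m : ℝ) ^ 2 * (1 + (ε + 1 / 10 + ε * (1 / 10))) ^ 2 ≤
          3 * L * θ₀ * (E.N m : ℝ) ^ 2 * (3 / 2) := mul_le_mul_of_nonneg_left hsq1 hβf0
      have t2 : (1 + ε) * (3 * L * θ₀ * (E.N m : ℝ) ^ 2) ≤ 11 / 10 * (3 * L * θ₀ * (E.N m : ℝ) ^ 2) :=
        mul_le_mul_of_nonneg_right (by linarith) hβf0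
      have t3 : L * θ₀ * (4 * (E.N m : ℝ) ^ 2) ≤ L * θ₀ * (E.N (m + 1) : ℝ) ^ 2 := mul_le_mul_of_nonneg_left h4 hLθ
      have t4 : L * θ₀ * (E.N (m + 1) : ℝ) ≤ L * θ₀ * ((E.N (m + 1) : ℝ) ^ 2 / 2) := mul_le_mul_of_nonneg_left hNN hLθ
      have t5 : (1 + 1 / 10) * (lam * (1 + 1 / 10) ^ 2) ≤ 1331 / 1000 * (11 / 10 * L * θ₀ * E.N (m + 1)) := by
        linarith only [hlam1]
      have t6 : 0 ≤ L * θ₀ * (E.N (m + 1) : ℝ) ^ 2 := mul_nonneg hLθ (sq_nonneg _)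
      linarith only [t1, t2, t3, t4, t5, t6]
    rw [hconj]
    exact ⟨fun z => by rw [hτ] at hD1'; exact hD1' z, hD1, hD2⟩

end Summit.AnomalousDissipation.AnomalousDissipation.Theorems.SolenoidalFractalHomogenisation.LagrangianCarrierConstruction

end
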